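import Summits.QuantumFields.YangMills.Theorems.BalabanUVNodesN11NoExpansionAtRecord13CoP

/-!
# DAG node N11 — THE NO-EXPANSION EQUATIONS OF (S1ᵀ)₁₃ AT THE v1.5 `CoP` RECORD, LEVEL k+1: the pre-𝐑 slot under `SLaw₁₃CoP θ p k`, the §2-form slot of
# 12a″'s weights at a no-expansion new sequence, and the level-(k+1) COHERENCE EQUATION `TLaw₁₃CoP θ p k` demands there (sequel of
# `BalabanUVNodesN11NoExpansionAtRecord13CoP`; the `CoP` twin of `Node00.TkNoExpansionAtRecord13` §3)

Cell `pub-ymgap`, YM-PLAN Track A (HUMAN RULING D-0062), seat `pub-ymgap-dag-n11-d` (g7; R134 fan-out seat N11 [B14], strategy s2), route `BalabanUVNodes`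
rev 21, item K1⁵ `StabilityBAtRecordR13SepCoP` = stmt-QuantumFields-20294 (helper, count-neutral; dag-lead WORDS-141).  [III] = [Balaban1988Convergent].

WHY THIS FILE.  N11's residue (S1ᵀ)₁₃CoP «`∀ k < K, SLaw₁₃CoP θ P k → TLaw₁₃CoP θ P k`» at a new sequence `s′` of length `k+1` WITHOUT new small-field region
(`Ω_{k+1}(s′) = ∅`: print performs no background-field expansion and creates no new terms there, (2.22) p. 258) is an equation between two sums of one-step
transports of record — def-T's pre-𝐑 slot `T_k[w(s′)·χ_k(init s′)·slot_k(init s′)]` against 11a's `𝐓_{k+1}(s′) = 𝐓^{(k)}𝐓_k(init s′)` applied to the §2 operand.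
This seat typed it at the Stage-12 and Stage-13 (12a, `T_η`-edition) records; here it is RE-KEYED at the v1.5 objects the K0⁵∕K1⁵ lanes now use — 12a″'s weights
`WtOfRecord₁₃P` (NO `χreg_k(T)` factor in the top generation) and def-R's support-edition backgrounds `UbgOfRecord₁₃CoP` — every proof being g3's GENERIC lemma
(`TkNoExpansionStepSucc`: `TkOfRecord_succ_ae_eq_sum_transportOfRecord_of_Omega_empty`, `transportK_congr_ae_family`) cited by name with the record letters swapped.

WHAT THIS FILE PROVES (0 `sorry`, 0 `def`, standard axioms; `N`-generic; `θ : Stage13Params F N` arbitrary, run `p`, `k < K`).  `slotsTOfRecord_succ_of_sLaw₁₃CoP`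
(under `SLaw₁₃CoP θ p k` the pre-𝐑 slot at level `k+1` is the transport of `w(s′)·χ_k·𝐓_k(init s′)e^{A_k(init s′)}` at the `CoP` objects, or the zero function);
`sect2Slot_succ_ae_eq_sum_transport_of_Omega_empty₁₃CoP` (the §2-form slot of `WtOfRecord₁₃P` at `s′`, a.e., as a sum over the old index of def-T's transports —
displayed measurability ∕ bound per old branch); `tLaw₁₃CoP_clause_of_Omega_empty` (the guard-free dichotomy at `s′`); ★ `tLaw₁₃CoP_coherence_of_Omega_empty` (THE
LEVEL-(k+1) COHERENCE EQUATION at the `CoP` record: `slotT_{k+1}(s′) ≡ 0` or, a.e.,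
`∫dU δ(ŪV′⁻¹) w(s′)χ_k(init s′)𝐓_k(init s′)e^{A_k(init s′)} = Σ_S ∫dU δ(ŪV′⁻¹) ζ0_k(T)·e^{−½quad_k(∅)}·[𝐓_k(init s′,S)e^{A_{k+1}(s′)}_S]`).

HONEST SCOPE.  Count-neutral kernel bookkeeping on the tree's OWN objects, a by-name re-key; NECESSARY conditions read off `TLaw₁₃CoP`, the operands `A_k(init s′)`,
`A_{k+1}(s′)` symbolic (along the all-large-field HISTORY both are the bare Wilson action by this seat's `action23_of_forall_Omega_empty`; the sufficiency
direction one level up — generation-`k` pins — is NOT in this file).  Nothing of Bałaban's asserted; N11 NOT discharged; counts unmoved (typed 28∕28 · discharged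
5∕28).  One finite four-torus programme at fixed `ε = L^{−K}`; NOT ℝ⁴, NOT OS, NOT a mass gap, NOT Clay.  Sources: [III] (2.18) p. 257, (2.20)–(2.23) p. 258,
(3.1) p. 264, (3.24)–(3.25) p. 270, Theorem p. 245, Thm 1 p. 262.
-/

noncomputable section

open MeasureTheory
open scoped BigOperators Matrix.Norms.L2Operator

namespace Summit.QuantumFields.YangMills.Theorems.BalabanUVNodesN11NoExpansionAtRecord13CoPSucc

open Literature.MathematicalPhysics.QuantumFieldTheory.Balaban1983to89 T4Continuum Node00 Node00.Tk DagBinding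
open B15DeterminingSets

variable {F : T4Family} {N : ℕ} [NeZero N]

/-! ## §1. LEVEL k+1 at the `CoP` record: the pre-𝐑 slot under `SLaw₁₃CoP θ p k`, the §2-form slot at a no-expansion `s′`, the coherence equation -/

section LevelSucc

variable (θ : Stage13Params F N) (p : B12.RunParams)

/-- **UNDER `SLaw₁₃CoP θ p k` THE PRE-𝐑 SLOT AT LEVEL k+1 IS THE TRANSPORT OF `w(s′)·χ_k·𝐓_k(init s′)e^{A_k(init s′)}`** (or the zero function) — the `CoP` twin of
`slotsTOfRecord_succ_of_sLaw₁₃` (`k < K`). [cite: Balaban1988Convergent, (2.18) p.257, Thm 1 p.262, (3.1) p.264, (3.25) p.270] -/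
theorem slotsTOfRecord_succ_of_sLaw₁₃CoP {k : ℕ} (hk : k < p.K) (hS : SLaw₁₃CoP F N θ p k)
    (s : SeqOfRecord F θ.ν θ.τ9.M (gOfRecord₁₃ F N θ p) p.K (k + 1)) :
    ∃ (t : SeqOfRecord F θ.ν θ.τ9.M (gOfRecord₁₃ F N θ p) p.K k → Sect2.TermValues (F.P p.K) (MatA N) (FluctV N) θ.τ9.M)
      (Ek : SeqOfRecord F θ.ν θ.τ9.M (gOfRecord₁₃ F N θ p) p.K k → ℝ),
      Sect2.UniversalE t ∧
      (∀ s₀, Sect2.LawsRT (sect2TowerOfRecord F N (FluctV N) p.K (settingOfRecord₁₃ F N θ p) (θ.Rz p.K) s₀ (t s₀)) (settingOfRecord₁₃ F N θ p).lf k) ∧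
      (slotsTOfRecord F N θ.ν θ.τ9 (EOfRecord₁₃ F N θ) (wOfRecord₉ F N θ.toStage9Params) θ.ppSel p
          (gOfRecord₁₃ F N θ p) (k + 1) s = 0 ∨
        slotsTOfRecord F N θ.ν θ.τ9 (EOfRecord₁₃ F N θ) (wOfRecord₉ F N θ.toStage9Params) θ.ppSel p
            (gOfRecord₁₃ F N θ p) (k + 1) s =ᵐ[fieldMeasure (F.P p.K) (k + 1) (SU N)]
          fun V' => transportOfRecord F N p.K k (fun U =>
            wOfRecord₉ F N θ.toStage9Params p (gOfRecord₁₃ F N θ p) k s U V' *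
              (chiSeqOfRecord F N θ.ν θ.τ9.M (gOfRecord₁₃ F N θ p) p.K k s.init U *
                sect2Slot F N (FluctV N) p.K (settingOfRecord₁₃ F N θ p) (θ.Rz p.K) (WtOfRecord₁₃P F N θ p) s.init (t s.init) (Ek s.init)
                  (UbgOfRecord₁₃CoP F N θ p k s.init) U)) V') := by
  obtain ⟨t, Ek, hu, hs⟩ := (sLaw₁₃CoP_iff F N θ p k).mp hS
  refine ⟨t, Ek, hu, fun s₀ => (hs s₀).1, ?_⟩
  rcases (hs s.init).2 with h0 | hid
  · refine Or.inl ?_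
    funext V'
    rw [slotsTOfRecord_succ_apply, h0]
    show transportOfRecord F N p.K k (fun U => _ * (_ * (0 : ℝ))) V' = 0
    simp only [mul_zero]
    show T4AveragingDisintegration.kernelTransport _ _ _ (fun _ => (0 : ℝ)) V' = 0
    simp only [T4AveragingDisintegration.kernelTransport, integral_zero, mul_zero]
  · refine Or.inr ?_
    have h := transportK_congr_ae_family (avOfRecord_measurable F N p.K k) (avOfRecord_haarAC F N p.K k hk)
      (f := fun V' U => wOfRecord₉ F N θ.toStage9Params p (gOfRecord₁₃ F N θ p) k s U V' *
        (chiSeqOfRecord F N θ.ν θ.τ9.M (gOfRecord₁₃ F N θ p) p.K k s.init U *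
          slotsOfRecord F N θ.ν θ.τ9 (EOfRecord₁₃ F N θ) (wOfRecord₉ F N θ.toStage9Params) θ.ppSel p
            (gOfRecord₁₃ F N θ p) k s.init U))
      (g := fun V' U => wOfRecord₉ F N θ.toStage9Params p (gOfRecord₁₃ F N θ p) k s U V' *
        (chiSeqOfRecord F N θ.ν θ.τ9.M (gOfRecord₁₃ F N θ p) p.K k s.init U *
          sect2Slot F N (FluctV N) p.K (settingOfRecord₁₃ F N θ p) (θ.Rz p.K) (WtOfRecord₁₃P F N θ p) s.init (t s.init) (Ek s.init)
            (UbgOfRecord₁₃CoP F N θ p k s.init) U))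
      (hid.mono fun U hU V' => by
        by_cases hχ : chiSeqOfRecord F N θ.ν θ.τ9.M (gOfRecord₁₃ F N θ p) p.K k s.init U = 0
        · simp only [hχ, zero_mul, mul_zero]
        · rw [hU hχ])
    filter_upwards [h] with V' hV'
    rw [slotsTOfRecord_succ_apply]
    exact hV'

/-- **THE §2-FORM SLOT `𝐓_{k+1}(s′)e^{A_{k+1}(s′)}` AT THE `CoP` OBJECTS AT A NO-EXPANSION `s′`, A.E. AS A SUM OF def-T's TRANSPORTS** (`k < K`; displayed joint
measurability + bound per old branch; g3's generic face at `W := WtOfRecord₁₃P θ p`). [cite: Balaban1988Convergent, (2.18) p.257, (3.1) p.264, (3.24)–(3.25) p.270] -/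
theorem sect2Slot_succ_ae_eq_sum_transport_of_Omega_empty₁₃CoP {k : ℕ} (hk : k < p.K)
    (s : SeqOfRecord F θ.ν θ.τ9.M (gOfRecord₁₃ F N θ p) p.K (k + 1)) (hΩ : s.Ω (k + 1) = ∅)
    (t : Sect2.TermValues (F.P p.K) (MatA N) (FluctV N) θ.τ9.M) (Ek : ℝ) (U : BgMap F N p.K) {C : ℝ}
    (hm : ∀ S ∈ admSOfRecord F θ.ν θ.τ9.M (gOfRecord₁₃ F N θ p) p.K k s.init,
      Measurable (Function.uncurry (noExpIntegrandAt F N (FluctV N) p.K k (WtOfRecord₁₃P F N θ p)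
        (tkBranchOfRecord F N (FluctV N) θ.ν θ.τ9.M _ p.K (WtOfRecord₁₃P F N θ p) s.init S k
          (fun ω => sect2Operand F N (FluctV N) p.K (settingOfRecord₁₃ F N θ p) (θ.Rz p.K) s t Ek U (S, fun j => (ω j).2) (fun j => (ω j).1))))))
    (hC : ∀ S ∈ admSOfRecord F θ.ν θ.τ9.M (gOfRecord₁₃ F N θ p) p.K k s.init, ∀ V' U₀,
      |noExpIntegrandAt F N (FluctV N) p.K k (WtOfRecord₁₃P F N θ p)
        (tkBranchOfRecord F N (FluctV N) θ.ν θ.τ9.M _ p.K (WtOfRecord₁₃P F N θ p) s.init S k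
          (fun ω => sect2Operand F N (FluctV N) p.K (settingOfRecord₁₃ F N θ p) (θ.Rz p.K) s t Ek U (S, fun j => (ω j).2) (fun j => (ω j).1)))
        V' U₀| ≤ C) :
    sect2Slot F N (FluctV N) p.K (settingOfRecord₁₃ F N θ p) (θ.Rz p.K) (WtOfRecord₁₃P F N θ p) s t Ek U =ᵐ[fieldMeasure (F.P p.K) (k + 1) (SU N)]
      fun V' => ∑ S ∈ admSOfRecord F θ.ν θ.τ9.M (gOfRecord₁₃ F N θ p) p.K k s.init,
        transportOfRecord F N p.K k (noExpIntegrandAt F N (FluctV N) p.K k (WtOfRecord₁₃P F N θ p)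
          (tkBranchOfRecord F N (FluctV N) θ.ν θ.τ9.M _ p.K (WtOfRecord₁₃P F N θ p) s.init S k
            (fun ω => sect2Operand F N (FluctV N) p.K (settingOfRecord₁₃ F N θ p) (θ.Rz p.K) s t Ek U (S, fun j => (ω j).2) (fun j => (ω j).1)))
          V') V' :=
  TkOfRecord_succ_ae_eq_sum_transportOfRecord_of_Omega_empty θ.ν θ.τ9.M _ p.K (WtOfRecord₁₃P F N θ p) hk s hΩ _ hm hC

/-- **THE (S1ᵀ)₁₃CoP,ₖ CLAUSE AT A NO-EXPANSION `s′`, GUARD-FREE**: if `TLaw₁₃CoP θ p k` holds, its witness satisfies at `s′` with `Ω_{k+1}(s′) = ∅` «`slotT_{k+1}(s′) = 0`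
or `slotT_{k+1}(s′)(V′) = 𝐓_{k+1}(s′)e^{A_{k+1}(s′)}(V′)` `dV′`-a.e.». [cite: Balaban1988Convergent, (3.25) p.270, remark p.262, Theorem p.245] -/
theorem tLaw₁₃CoP_clause_of_Omega_empty {k : ℕ} (hT : TLaw₁₃CoP F N θ p k)
    (s : SeqOfRecord F θ.ν θ.τ9.M (gOfRecord₁₃ F N θ p) p.K (k + 1)) (hΩ : s.Ω (k + 1) = ∅) :
    ∃ (t : SeqOfRecord F θ.ν θ.τ9.M (gOfRecord₁₃ F N θ p) p.K (k + 1) → Sect2.TermValues (F.P p.K) (MatA N) (FluctV N) θ.τ9.M)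
      (Ek : SeqOfRecord F θ.ν θ.τ9.M (gOfRecord₁₃ F N θ p) p.K (k + 1) → ℝ),
      Sect2.UniversalE t ∧
      (∀ s', Sect2.LawsT (sect2TowerOfRecord F N (FluctV N) p.K (settingOfRecord₁₃ F N θ p) (θ.Rz p.K) s' (t s'))
        (settingOfRecord₁₃ F N θ p).lf (settingOfRecord₁₃ F N θ p).βc k) ∧
      (slotsTOfRecord F N θ.ν θ.τ9 (EOfRecord₁₃ F N θ) (wOfRecord₉ F N θ.toStage9Params) θ.ppSel p
          (gOfRecord₁₃ F N θ p) (k + 1) s = 0 ∨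
        ∀ᵐ V' ∂fieldMeasure (F.P p.K) (k + 1) (SU N),
          slotsTOfRecord F N θ.ν θ.τ9 (EOfRecord₁₃ F N θ) (wOfRecord₉ F N θ.toStage9Params) θ.ppSel p
              (gOfRecord₁₃ F N θ p) (k + 1) s V' =
            sect2Slot F N (FluctV N) p.K (settingOfRecord₁₃ F N θ p) (θ.Rz p.K) (WtOfRecord₁₃P F N θ p) s (t s) (Ek s)
              (UbgOfRecord₁₃CoP F N θ p (k + 1) s) V') := by
  obtain ⟨t, Ek, hu, hs⟩ := (tLaw₁₃CoP_iff F N θ p k).mp hT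
  refine ⟨t, Ek, hu, fun s' => (hs s').1, ?_⟩
  rcases (hs s).2 with h0 | hid
  · exact Or.inl h0
  · refine Or.inr ?_
    filter_upwards [hid] with V' hV'
    exact hV' (by rw [chiSeqOfRecord_eq_one_of_Omega_empty F N θ.ν θ.τ9.M _ p.K (k + 1) s hΩ V']; exact one_ne_zero)

/-- **★ THE LEVEL-(k+1) NO-EXPANSION COHERENCE EQUATION AT THE `CoP` RECORD, IN KERNEL**: at `s′` with `Ω_{k+1}(s′) = ∅`, `k < K`, given the §2 identity of
`ρ_k`'s slot at `init s′` at the `CoP` objects (a witness `(t, E_k)` of `SLaw₁₃CoP θ p k`, identity branch) and a witness pair `(t′, E_{k+1})` of the (S1ᵀ)₁₃CoP,ₖ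
dichotomy at `s′`, under the displayed measurability ∕ boundedness of the old-branch integrands: EITHER `slotT_{k+1}(s′) ≡ 0` OR, `dV′`-a.e.,
`∫dU δ(ŪV′⁻¹) w(s′)(U,V′)·χ_k(init s′)(U)·𝐓_k(init s′)e^{A_k(init s′)}(U) = Σ_S ∫dU δ(ŪV′⁻¹) ζ0_k(T)·e^{−½quad_k(∅)}·[𝐓_k(init s′,S)e^{A_{k+1}(s′)}_S](U,V′)` —
NO `χreg_k(T)` factor (12a″). [cite: Balaban1988Convergent, Theorem p.245, (3.1) p.264, (3.24)–(3.25) p.270, (2.18) p.257, (2.21)–(2.23) p.258] -/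
theorem tLaw₁₃CoP_coherence_of_Omega_empty {k : ℕ} (hk : k < p.K)
    (s : SeqOfRecord F θ.ν θ.τ9.M (gOfRecord₁₃ F N θ p) p.K (k + 1)) (hΩ : s.Ω (k + 1) = ∅)
    (t : Sect2.TermValues (F.P p.K) (MatA N) (FluctV N) θ.τ9.M) (Ek : ℝ)
    (hid : ∀ᵐ U₀ ∂fieldMeasure (F.P p.K) k (SU N),
      chiSeqOfRecord F N θ.ν θ.τ9.M (gOfRecord₁₃ F N θ p) p.K k s.init U₀ ≠ 0 →
        slotsOfRecord F N θ.ν θ.τ9 (EOfRecord₁₃ F N θ) (wOfRecord₉ F N θ.toStage9Params) θ.ppSel p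
            (gOfRecord₁₃ F N θ p) k s.init U₀ =
          sect2Slot F N (FluctV N) p.K (settingOfRecord₁₃ F N θ p) (θ.Rz p.K) (WtOfRecord₁₃P F N θ p) s.init t Ek
            (UbgOfRecord₁₃CoP F N θ p k s.init) U₀)
    (t' : Sect2.TermValues (F.P p.K) (MatA N) (FluctV N) θ.τ9.M) (Ek' : ℝ)
    (hcl : slotsTOfRecord F N θ.ν θ.τ9 (EOfRecord₁₃ F N θ) (wOfRecord₉ F N θ.toStage9Params) θ.ppSel p
          (gOfRecord₁₃ F N θ p) (k + 1) s = 0 ∨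
        ∀ᵐ V' ∂fieldMeasure (F.P p.K) (k + 1) (SU N),
          slotsTOfRecord F N θ.ν θ.τ9 (EOfRecord₁₃ F N θ) (wOfRecord₉ F N θ.toStage9Params) θ.ppSel p
              (gOfRecord₁₃ F N θ p) (k + 1) s V' =
            sect2Slot F N (FluctV N) p.K (settingOfRecord₁₃ F N θ p) (θ.Rz p.K) (WtOfRecord₁₃P F N θ p) s t' Ek'
              (UbgOfRecord₁₃CoP F N θ p (k + 1) s) V')
    {C : ℝ}
    (hm : ∀ S ∈ admSOfRecord F θ.ν θ.τ9.M (gOfRecord₁₃ F N θ p) p.K k s.init,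
      Measurable (Function.uncurry (noExpIntegrandAt F N (FluctV N) p.K k (WtOfRecord₁₃P F N θ p)
        (tkBranchOfRecord F N (FluctV N) θ.ν θ.τ9.M _ p.K (WtOfRecord₁₃P F N θ p) s.init S k
          (fun ω => sect2Operand F N (FluctV N) p.K (settingOfRecord₁₃ F N θ p) (θ.Rz p.K) s t' Ek' (UbgOfRecord₁₃CoP F N θ p (k + 1) s)
            (S, fun j => (ω j).2) (fun j => (ω j).1))))))
    (hC : ∀ S ∈ admSOfRecord F θ.ν θ.τ9.M (gOfRecord₁₃ F N θ p) p.K k s.init, ∀ V' U₀,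
      |noExpIntegrandAt F N (FluctV N) p.K k (WtOfRecord₁₃P F N θ p)
        (tkBranchOfRecord F N (FluctV N) θ.ν θ.τ9.M _ p.K (WtOfRecord₁₃P F N θ p) s.init S k
          (fun ω => sect2Operand F N (FluctV N) p.K (settingOfRecord₁₃ F N θ p) (θ.Rz p.K) s t' Ek' (UbgOfRecord₁₃CoP F N θ p (k + 1) s)
            (S, fun j => (ω j).2) (fun j => (ω j).1)))
        V' U₀| ≤ C) :
    slotsTOfRecord F N θ.ν θ.τ9 (EOfRecord₁₃ F N θ) (wOfRecord₉ F N θ.toStage9Params) θ.ppSel p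
        (gOfRecord₁₃ F N θ p) (k + 1) s = 0 ∨
      (fun V' => transportOfRecord F N p.K k (fun U₀ =>
          wOfRecord₉ F N θ.toStage9Params p (gOfRecord₁₃ F N θ p) k s U₀ V' *
            (chiSeqOfRecord F N θ.ν θ.τ9.M (gOfRecord₁₃ F N θ p) p.K k s.init U₀ *
              sect2Slot F N (FluctV N) p.K (settingOfRecord₁₃ F N θ p) (θ.Rz p.K) (WtOfRecord₁₃P F N θ p) s.init t Ek
                (UbgOfRecord₁₃CoP F N θ p k s.init) U₀)) V')
        =ᵐ[fieldMeasure (F.P p.K) (k + 1) (SU N)]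
      fun V' => ∑ S ∈ admSOfRecord F θ.ν θ.τ9.M (gOfRecord₁₃ F N θ p) p.K k s.init,
        transportOfRecord F N p.K k (noExpIntegrandAt F N (FluctV N) p.K k (WtOfRecord₁₃P F N θ p)
          (tkBranchOfRecord F N (FluctV N) θ.ν θ.τ9.M _ p.K (WtOfRecord₁₃P F N θ p) s.init S k
            (fun ω => sect2Operand F N (FluctV N) p.K (settingOfRecord₁₃ F N θ p) (θ.Rz p.K) s t' Ek' (UbgOfRecord₁₃CoP F N θ p (k + 1) s)
              (S, fun j => (ω j).2) (fun j => (ω j).1)))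
          V') V' := by
  rcases hcl with h0 | hcl
  · exact Or.inl h0
  · refine Or.inr ?_
    have h1 := transportK_congr_ae_family (avOfRecord_measurable F N p.K k) (avOfRecord_haarAC F N p.K k hk)
      (f := fun V' U₀ => wOfRecord₉ F N θ.toStage9Params p (gOfRecord₁₃ F N θ p) k s U₀ V' *
        (chiSeqOfRecord F N θ.ν θ.τ9.M (gOfRecord₁₃ F N θ p) p.K k s.init U₀ *
          slotsOfRecord F N θ.ν θ.τ9 (EOfRecord₁₃ F N θ) (wOfRecord₉ F N θ.toStage9Params) θ.ppSel p
            (gOfRecord₁₃ F N θ p) k s.init U₀))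
      (g := fun V' U₀ => wOfRecord₉ F N θ.toStage9Params p (gOfRecord₁₃ F N θ p) k s U₀ V' *
        (chiSeqOfRecord F N θ.ν θ.τ9.M (gOfRecord₁₃ F N θ p) p.K k s.init U₀ *
          sect2Slot F N (FluctV N) p.K (settingOfRecord₁₃ F N θ p) (θ.Rz p.K) (WtOfRecord₁₃P F N θ p) s.init t Ek
            (UbgOfRecord₁₃CoP F N θ p k s.init) U₀))
      (hid.mono fun U₀ hU V' => by
        by_cases hχ : chiSeqOfRecord F N θ.ν θ.τ9.M (gOfRecord₁₃ F N θ p) p.K k s.init U₀ = 0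
        · simp only [hχ, zero_mul, mul_zero]
        · rw [hU hχ])
    have h2 := sect2Slot_succ_ae_eq_sum_transport_of_Omega_empty₁₃CoP θ p hk s hΩ t' Ek' (UbgOfRecord₁₃CoP F N θ p (k + 1) s) hm hC
    filter_upwards [hcl, h1, h2] with V' e0 e1 e2
    rw [← e2, ← e0, slotsTOfRecord_succ_apply]
    exact e1.symm

end LevelSucc

end Summit.QuantumFields.YangMills.Theorems.BalabanUVNodesN11NoExpansionAtRecord13CoPSucc

end
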